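import Summits.BirchSwinnertonDyer.BirchSwinnertonDyer.Theorems.GenusKolyvaginAtTwoPowDvdShaCardAtTwoRTKolyvaginSuppliesOfDeepSwap
import Summits.BirchSwinnertonDyer.BirchSwinnertonDyer.Theorems.GenusKolyvaginAtTwoPowDvdShaCardAtTwoRTExactSwapHybridFrob
import Summits.BirchSwinnertonDyer.BirchSwinnertonDyer.Theorems.GenusKolyvaginAtTwoPowDvdShaCardAtTwoRTBottomRungTransverseSocket
import Summits.BirchSwinnertonDyer.BirchSwinnertonDyer.Theorems.GenusKolyvaginAtTwoPowDvdShaCardAtTwoRTEigenIndexSocket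
import Summits.BirchSwinnertonDyer.BirchSwinnertonDyer.Theorems.Rank1ResidualJetRingClassFields
import HarnessLib

/-!
# Route `GenusKolyvaginAtTwo`, LINE 18 (L_T `PowDvdShaCardAtTwoRT`, stmt-BirchSwinnertonDyer-23242), stub KS / stub L —
# THE BY-NAME COMPOSITION OVER THE THREE SOCKETS: KS's registered conclusion and L's conclusion modulo {Q2, (NPh) or the (D-NPh) place,
# a Gross witness} ONLY

Seat `bsd-line-gk2-p3` g24 (PROVER seat 3/3, cell `bsd-f1-sign2`), `--supports stmt-BirchSwinnertonDyer-23242` (helper; closes nothing).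
THEOREMS ONLY (no definition, no named fact, no `sorry`).  BSD is NOT proved by any of this; stub KS / stub L are NOT closed here
(the registered texts start from the crux's SHALLOW witness `hPn`; the Gross witness below is skeleton v5.3's stub W-UP).

WHAT.  gk2-p2 g19's KS assembly `kolyvaginSuppliesAtTwo_of_deepSwap` (p727242; conclusion = the REGISTERED conclusion of
`stub_kolyvaginSystemAtTwo`, v5.2) and `twinShaLadders_of_deepSwap` (stub L's conclusion) display three sockets `hbot`, `hswap`, `hK` over a
prime class `G`.  For the margin-`k` class `G q := L + k ≤ M(q) ∧ FrobEqFrobInfty W K (2^(L+k)) q` ALL THREE are now tree theorems: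
* `hbot` := this seat's `TransverseValue.hbot_socket_margin_of_three_le` / `…_onHabitat_of_three_le` (p734489: gk2-p5 g24's socket with the
  (V44)-input `hTr` DISCHARGED — Howard 2.7.3 at `2` read at `τ_{F²}`), from a level-`4` (resp. level-`2`, on the cut habitat) Gross witness;
* `hswap` := LEAD gk2-p1 g18's `PlusDescent.deepSwap_socket` (p734487: the EXACT prime swap at `2`, McCallum Prop. 5.2's step, lossless on
  `Δ < 0`, laws of the gk2-p3 lineage plugged, frame instantiated), `k ≥ 1`, `L ≥ 2M₀ + 12`;
* `hK` := gk2-p5 g23's `PlusDescent.hK_socket_margin` (p727553: the eigen index law at a Gross prime).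
This file composes them:
* `kolyvaginSuppliesAtTwo_of_grossWitness` — KS's registered conclusion at level `L` (`2M₀ + 12 ≤ L`, `k ≥ 1`) modulo Q2, (NPh_{L+k}) in the
  robust `2N`-form, and a level-`4` Gross witness (`n₀` square-free of Zhang–Kolyvagin primes of index `≥ 2` with `FrobEqFrobInfty W K 4`, a
  datum with `addOrderOf c₂(e₀) = 4`);
* `twinShaLadders_of_grossWitness` — stub L's conclusion from the same plus `PubInputsAtTwo`;
* `kolyvaginSuppliesAtTwo_of_grossWitness_onHabitat`, `twinShaLadders_of_grossWitness_onHabitat` — ON THE CUT HABITAT («∃ odd place `v ∣ N`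
  of multiplicative reduction», planner (D-NPh), rev 31): (NPh) DISCHARGED (`NonPhantomPow.nonPhantomAtTwo_of_hasMultiplicativeReductionAt`,
  gk2-p3 g22), the witness in Kolyvagin's divisibility currency `P(n₀) ∉ 2E(K[n₀])` at LEVEL-2 Gross primes of index `≥ 2` (skeleton v5.3's
  stub W-UP output) — displayed residuals: Q2 `KolyvaginRelationAtTwo` (the crux's own antecedent) and the W-UP witness, nothing else.
HONEST FRAMING: pure composition of landed theorems (gk2-p2 assembly, LEAD swap, gk2-p5 index law / socket, gk2-p3 hTr); closes nothing.

References: [McCallumLMS1991] §5 Prop. 5.2, Lemma 5.3, Thm. 5.4; [Kolyvagin1991MathAnn] §2 Thm. 2.1–2.2; [GrossLMS1991] §3 (3.1)–(3.3), Prop. 3.7,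
§4 (4.1), Prop. 6.2; [Howard2004HeegnerKolyvagin] Lemma 2.7.3; [LawsonWuthrich2016] §7.1.
-/

set_option autoImplicit false
-- the Theorems namespace of this sub repeats the summit name by design (D-0017 nested layout)
set_option linter.dupNamespace false

noncomputable section

open scoped Classical

namespace Summit.BirchSwinnertonDyer.BirchSwinnertonDyer.Theorems.GenusExact.PlusDescent

open WeierstrassCurve NumberField IsDedekindDomain Field Literature.NumberTheory.EllipticCurves
  Literature.NumberTheory.GaloisRepresentations Literature.NumberTheory.EllipticCurves.ModularForms AddSubgroup
open Summit.BirchSwinnertonDyer.BirchSwinnertonDyer.Theses.GenusKolyvaginAtTwo (KolyvaginRelationAtTwo)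
open Summit.BirchSwinnertonDyer.Rank1Residual

variable {K : Type} [Field K] [NumberField K]

/-- **KS's registered conclusion from a level-`4` Gross witness, modulo Q2 and (NPh_{L+k})** — `kolyvaginSuppliesAtTwo_of_deepSwap` over the
margin-`k` class with its three sockets SUPPLIED (`hbot_socket_margin_of_three_le`, `deepSwap_socket`, `hK_socket_margin`).  Level `L ≥ 2M₀ + 12`,
depth `k ≥ 1`; the (NPh) hypothesis is the robust `2N`-form at level `2^(L+k)`.
[cite: McCallumLMS1991, §5 Prop. 5.2, Lemma 5.1, Cor. 4.5] [cite: Kolyvagin1991MathAnn, Thm. 2.1–2.2] [cite: GrossLMS1991, §3 (3.1)–(3.3)] -/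
theorem kolyvaginSuppliesAtTwo_of_grossWitness (W : WeierstrassCurve ℚ) [W.IsElliptic] [W.IsGloballyMinimal]
    [NeZero (W.conductorNorm ℤ)]
    (hQ2 : KolyvaginRelationAtTwo) (hcm : ¬ W.HasCM) (hΔ : W.Δ < 0) (hT : Odd W.tamagawaProduct)
    (hρ : ∀ m : ℕ, W.HasSurjectiveModNGaloisRep (2 ^ m : ℕ))
    (hIQ : IsImaginaryQuadratic K) (hodd : Odd (NumberField.discr K)) (h3 : NumberField.discr K ≠ -3)
    (hHe : SatisfiesHeegnerHypothesis (W.conductorNorm ℤ) K) (hns : ¬ IsSquare ((NumberField.discr K : ℚ) * -|W.Δ|))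
    (τ : K ≃ₐ[ℚ] K) (hτ : τ ≠ 1)
    (Dt : ModularParametrizationData W (W.conductorNorm ℤ)) (β : ℤ) (ι : K →+* ℂ)
    (d₁ : KolyvaginHeegnerData Dt β ι 1) (M₀ : ℕ)
    (hM₀ : ∃ Q : (W.baseChange (ringClassField K ι 1)).toAffine.Point, ((2 ^ M₀ : ℕ) : ℤ) • Q = d₁.derivedPoint)
    (hndiv : ¬ ∃ Q : (W.baseChange (ringClassField K ι 1)).toAffine.Point, ((2 ^ (M₀ + 1) : ℕ) : ℤ) • Q = d₁.derivedPoint)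
    {L k : ℕ} (hL : 2 * M₀ + 12 ≤ L) (hk : 1 ≤ k)
    (hNPh : ∀ z : galH1Torsion (W.baseChange K) ((2 ^ (L + k) : ℕ) : ℤ),
      (∀ ρ ∈ torsionFixing (W.baseChange K) ((2 ^ (L + k) : ℕ) : ℤ),
        h1Eval (W.baseChange K) ((2 ^ (L + k) : ℕ) : ℤ) z ρ = 0) →
      (∀ w : HeightOneSpectrum (𝓞 K), ((2 * W.conductorNorm ℤ : ℕ) : 𝓞 K) ∈ w.asIdeal →
        z ∈ selmerLocalKer (W.baseChange K) (w.adicCompletion K) ((2 ^ (L + k) : ℕ) : ℤ)) → z = 0)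
    {n₀ : ℕ} (hn₀ : Squarefree n₀)
    (hn₀K : ∀ q ∈ n₀.primeFactors, Zhang2014.IsKolyvaginPrime (W.conductorNorm ℤ) W K 2 q ∧ 2 ≤ Zhang2014.kolyvaginIndex W 2 q ∧
      FrobEqFrobInfty W K (2 ^ 2) q)
    (e₀ : KolyvaginHeegnerData Dt β ι n₀) (he₀ : addOrderOf (e₀.kolyvaginClass Nat.prime_two 2) = 2 ^ 2) :
    ∃ (R : ℕ) (Mr : ℕ → ℕ), (∀ j, Mr (j + 1) ≤ Mr j) ∧ Mr 0 = M₀ ∧ Mr R = 0 ∧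
      (∀ m : ℕ, Mr (2 * m + 1) < Mr (2 * m) →
        ∀ (i : ℕ) (u : Fin i → galH1Torsion (W.baseChange K) ((2 ^ L : ℕ) : ℤ)), i ≤ 2 * m + 1 →
        (∀ j, u j ∈ selmerGroup (W.baseChange K) ((2 ^ L : ℕ) : ℤ) ∧
          conjAct W τ ((2 ^ L : ℕ) : ℤ) (u j) = W.rootNumber • u j) →
        ∃ (n : ℕ) (_ : Squarefree n)
          (_ : ∀ ℓ ∈ n.primeFactors, Zhang2014.IsKolyvaginPrime (W.conductorNorm ℤ) W K 2 ℓ ∧ L ≤ Zhang2014.kolyvaginIndex W 2 ℓ)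
          (d : KolyvaginHeegnerData Dt β ι n),
          (∀ ℓ ∈ n.primeFactors, ∀ e : KolyvaginHeegnerData Dt β ι (n / ℓ),
            ((2 ^ (L - Mr (2 * m)) : ℕ) : ℤ) • e.kolyvaginClass Nat.prime_two L = 0) ∧
          addOrderOf (d.kolyvaginClass Nat.prime_two L) = 2 ^ (L - Mr (2 * m + 1)) ∧
          -W.rootNumber * (-1) ^ n.primeFactors.card = W.rootNumber ∧
          Disjoint (zmultiples (((2 ^ (L - Mr (2 * m)) : ℕ) : ℤ) • d.kolyvaginClass Nat.prime_two L))
            (AddSubgroup.closure (Set.range u))) ∧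
      (∀ m : ℕ, Mr (2 * m + 2) < Mr (2 * m + 1) →
        ∀ (i : ℕ) (u : Fin i → galH1Torsion (W.baseChange K) ((2 ^ L : ℕ) : ℤ)), i ≤ 2 * m + 1 →
        (∀ j, u j ∈ selmerGroup (W.baseChange K) ((2 ^ L : ℕ) : ℤ) ∧
          conjAct W τ ((2 ^ L : ℕ) : ℤ) (u j) = (-W.rootNumber) • u j) →
        ∃ (n : ℕ) (_ : Squarefree n)
          (_ : ∀ ℓ ∈ n.primeFactors, Zhang2014.IsKolyvaginPrime (W.conductorNorm ℤ) W K 2 ℓ ∧ L ≤ Zhang2014.kolyvaginIndex W 2 ℓ)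
          (d : KolyvaginHeegnerData Dt β ι n),
          (∀ ℓ ∈ n.primeFactors, ∀ e : KolyvaginHeegnerData Dt β ι (n / ℓ),
            ((2 ^ (L - Mr (2 * m + 1)) : ℕ) : ℤ) • e.kolyvaginClass Nat.prime_two L = 0) ∧
          addOrderOf (d.kolyvaginClass Nat.prime_two L) = 2 ^ (L - Mr (2 * m + 2)) ∧
          -W.rootNumber * (-1) ^ n.primeFactors.card = -W.rootNumber ∧
          Disjoint (zmultiples (((2 ^ (L - Mr (2 * m + 1)) : ℕ) : ℤ) • d.kolyvaginClass Nat.prime_two L))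
            (AddSubgroup.closure (Set.range u) ⊔ zmultiples (d₁.kolyvaginClass Nat.prime_two L))) := by
  haveI : ∀ j : ℕ, NumberField (ringClassField K ι j) := JET.numberField_ringClassField K hIQ ι
  exact kolyvaginSuppliesAtTwo_of_deepSwap W hQ2 hcm hΔ hT hρ hIQ hodd h3 hHe hns τ hτ Dt β ι d₁ M₀ hM₀ hndiv (L := L)
    (by omega) k (fun z hz hzS ↦ hNPh z hz fun w _ ↦ hzS w)
    (fun q ↦ L + k ≤ Zhang2014.kolyvaginIndex W 2 q ∧ FrobEqFrobInfty W K (2 ^ (L + k)) q) (fun q _ hidx hF ↦ ⟨hidx, hF⟩)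
    (TransverseValue.hbot_socket_margin_of_three_le W hQ2 hcm hΔ hT hρ hIQ hodd h3 hHe hns Dt β ι (L := L) (by omega) k
      (by omega) hNPh _ (fun q _ hidx hF ↦ ⟨hidx, hF⟩) hn₀ hn₀K e₀ he₀)
    (deepSwap_socket W hcm hΔ hT hρ hIQ hodd h3 hns hHe τ hτ Dt β ι hQ2 hL hk hNPh)
    (fun r ℓ hℓ C hC ↦ hK_socket_margin W hΔ hIQ hτ (L := L) (by omega) r k ℓ hℓ C hC)

/-- **KS's registered conclusion ON THE CUT HABITAT, modulo Q2 and a level-`2` Gross witness only** («∃ odd place `v ∣ N` of multiplicative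
reduction» (D-NPh): (NPh) DISCHARGED by `NonPhantomPow.nonPhantomAtTwo_of_hasMultiplicativeReductionAt`; the witness in Kolyvagin's divisibility
currency `P(n₀) ∉ 2E(K[n₀])` at level-`2` Gross primes of index `≥ 2` = skeleton v5.3's stub W-UP output).  Level `L ≥ 2M₀ + 12`, `k ≥ 1`.
[cite: McCallumLMS1991, §5 Prop. 5.2] [cite: Kolyvagin1991MathAnn, Thm. 2.1–2.2] [cite: GrossLMS1991, §3 (3.3)] [cite: LawsonWuthrich2016, §7.1] -/
theorem kolyvaginSuppliesAtTwo_of_grossWitness_onHabitat (W : WeierstrassCurve ℚ) [W.IsElliptic] [W.IsGloballyMinimal]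
    [NeZero (W.conductorNorm ℤ)]
    (hQ2 : KolyvaginRelationAtTwo) (hcm : ¬ W.HasCM) (hΔ : W.Δ < 0) (hT : Odd W.tamagawaProduct)
    (hρ : ∀ m : ℕ, W.HasSurjectiveModNGaloisRep (2 ^ m : ℕ))
    (hIQ : IsImaginaryQuadratic K) (hodd : Odd (NumberField.discr K)) (h3 : NumberField.discr K ≠ -3)
    (hHe : SatisfiesHeegnerHypothesis (W.conductorNorm ℤ) K) (hns : ¬ IsSquare ((NumberField.discr K : ℚ) * -|W.Δ|))
    (hns₂ : ¬ IsSquare ((NumberField.discr K : ℚ) * (-(2 * |W.Δ|))))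
    {v : HeightOneSpectrum (𝓞 ℚ)} (h2v : ((2 : ℕ) : 𝓞 ℚ) ∉ v.asIdeal) (hNv : ((W.conductorNorm ℤ : ℕ) : 𝓞 ℚ) ∈ v.asIdeal)
    (hmult : W.HasMultiplicativeReductionAt v)
    (τ : K ≃ₐ[ℚ] K) (hτ : τ ≠ 1)
    (Dt : ModularParametrizationData W (W.conductorNorm ℤ)) (β : ℤ) (ι : K →+* ℂ)
    (d₁ : KolyvaginHeegnerData Dt β ι 1) (M₀ : ℕ)
    (hM₀ : ∃ Q : (W.baseChange (ringClassField K ι 1)).toAffine.Point, ((2 ^ M₀ : ℕ) : ℤ) • Q = d₁.derivedPoint)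
    (hndiv : ¬ ∃ Q : (W.baseChange (ringClassField K ι 1)).toAffine.Point, ((2 ^ (M₀ + 1) : ℕ) : ℤ) • Q = d₁.derivedPoint)
    {L k : ℕ} (hL : 2 * M₀ + 12 ≤ L) (hk : 1 ≤ k)
    {n₀ : ℕ} (hn₀ : Squarefree n₀)
    (hn₀K : ∀ q ∈ n₀.primeFactors, Zhang2014.IsKolyvaginPrime (W.conductorNorm ℤ) W K 2 q ∧ 2 ≤ Zhang2014.kolyvaginIndex W 2 q ∧
      FrobEqFrobInfty W K 2 q)
    (e₀ : KolyvaginHeegnerData Dt β ι n₀)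
    (he₀ : ¬ ∃ Q : (W.baseChange (ringClassField K ι n₀)).toAffine.Point, (2 : ℤ) • Q = e₀.derivedPoint) :
    ∃ (R : ℕ) (Mr : ℕ → ℕ), (∀ j, Mr (j + 1) ≤ Mr j) ∧ Mr 0 = M₀ ∧ Mr R = 0 ∧
      (∀ m : ℕ, Mr (2 * m + 1) < Mr (2 * m) →
        ∀ (i : ℕ) (u : Fin i → galH1Torsion (W.baseChange K) ((2 ^ L : ℕ) : ℤ)), i ≤ 2 * m + 1 →
        (∀ j, u j ∈ selmerGroup (W.baseChange K) ((2 ^ L : ℕ) : ℤ) ∧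
          conjAct W τ ((2 ^ L : ℕ) : ℤ) (u j) = W.rootNumber • u j) →
        ∃ (n : ℕ) (_ : Squarefree n)
          (_ : ∀ ℓ ∈ n.primeFactors, Zhang2014.IsKolyvaginPrime (W.conductorNorm ℤ) W K 2 ℓ ∧ L ≤ Zhang2014.kolyvaginIndex W 2 ℓ)
          (d : KolyvaginHeegnerData Dt β ι n),
          (∀ ℓ ∈ n.primeFactors, ∀ e : KolyvaginHeegnerData Dt β ι (n / ℓ),
            ((2 ^ (L - Mr (2 * m)) : ℕ) : ℤ) • e.kolyvaginClass Nat.prime_two L = 0) ∧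
          addOrderOf (d.kolyvaginClass Nat.prime_two L) = 2 ^ (L - Mr (2 * m + 1)) ∧
          -W.rootNumber * (-1) ^ n.primeFactors.card = W.rootNumber ∧
          Disjoint (zmultiples (((2 ^ (L - Mr (2 * m)) : ℕ) : ℤ) • d.kolyvaginClass Nat.prime_two L))
            (AddSubgroup.closure (Set.range u))) ∧
      (∀ m : ℕ, Mr (2 * m + 2) < Mr (2 * m + 1) →
        ∀ (i : ℕ) (u : Fin i → galH1Torsion (W.baseChange K) ((2 ^ L : ℕ) : ℤ)), i ≤ 2 * m + 1 →
        (∀ j, u j ∈ selmerGroup (W.baseChange K) ((2 ^ L : ℕ) : ℤ) ∧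
          conjAct W τ ((2 ^ L : ℕ) : ℤ) (u j) = (-W.rootNumber) • u j) →
        ∃ (n : ℕ) (_ : Squarefree n)
          (_ : ∀ ℓ ∈ n.primeFactors, Zhang2014.IsKolyvaginPrime (W.conductorNorm ℤ) W K 2 ℓ ∧ L ≤ Zhang2014.kolyvaginIndex W 2 ℓ)
          (d : KolyvaginHeegnerData Dt β ι n),
          (∀ ℓ ∈ n.primeFactors, ∀ e : KolyvaginHeegnerData Dt β ι (n / ℓ),
            ((2 ^ (L - Mr (2 * m + 1)) : ℕ) : ℤ) • e.kolyvaginClass Nat.prime_two L = 0) ∧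
          addOrderOf (d.kolyvaginClass Nat.prime_two L) = 2 ^ (L - Mr (2 * m + 2)) ∧
          -W.rootNumber * (-1) ^ n.primeFactors.card = -W.rootNumber ∧
          Disjoint (zmultiples (((2 ^ (L - Mr (2 * m + 1)) : ℕ) : ℤ) • d.kolyvaginClass Nat.prime_two L))
            (AddSubgroup.closure (Set.range u) ⊔ zmultiples (d₁.kolyvaginClass Nat.prime_two L))) := by
  haveI : ∀ j : ℕ, NumberField (ringClassField K ι j) := JET.numberField_ringClassField K hIQ ι
  have hρ' : ∀ n : ℕ, 0 < n → W.HasSurjectiveModNGaloisRep ((2 : ℤ) ^ n) := fun n _ ↦ by exact_mod_cast hρ n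
  have hNPh := NonPhantomPow.nonPhantomAtTwo_of_hasMultiplicativeReductionAt W hT hρ' hIQ hodd hns hns₂
    (NeZero.ne (W.conductorNorm ℤ)) hHe h2v hNv hmult (L + k) (by omega)
  exact kolyvaginSuppliesAtTwo_of_deepSwap W hQ2 hcm hΔ hT hρ hIQ hodd h3 hHe hns τ hτ Dt β ι d₁ M₀ hM₀ hndiv (L := L)
    (by omega) k (fun z hz hzS ↦ hNPh z hz fun w _ ↦ hzS w)
    (fun q ↦ L + k ≤ Zhang2014.kolyvaginIndex W 2 q ∧ FrobEqFrobInfty W K (2 ^ (L + k)) q) (fun q _ hidx hF ↦ ⟨hidx, hF⟩)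
    (TransverseValue.hbot_socket_margin_onHabitat_of_three_le W hQ2 hcm hΔ hT hρ hIQ hodd h3 hHe hns hns₂ h2v hNv hmult Dt β ι
      (L := L) (by omega) k (by omega) _ (fun q _ hidx hF ↦ ⟨hidx, hF⟩) hn₀ hn₀K e₀ he₀)
    (deepSwap_socket W hcm hΔ hT hρ hIQ hodd h3 hns hHe τ hτ Dt β ι hQ2 hL hk hNPh)
    (fun r ℓ hℓ C hC ↦ hK_socket_margin W hΔ hIQ hτ (L := L) (by omega) r k ℓ hℓ C hC)

/-- **Stub L's conclusion (the two ℚ-side Ш-ladders) from a level-`4` Gross witness, modulo Q2, `PubInputsAtTwo` and (NPh_{L+k})** —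
gk2-p2's `twinShaLadders_of_deepSwap` (capstone′ p708383 ∘ the KS assembly) with the three sockets supplied.
[cite: McCallumLMS1991, §5 Prop. 5.2, Thm. 5.4] [cite: GrossLMS1991, Thm. 1.3, §4 (4.1), Prop. 5.3] -/
theorem twinShaLadders_of_grossWitness (hP : PubInputsAtTwo) (hQ2 : KolyvaginRelationAtTwo)
    (W : WeierstrassCurve ℚ) [W.IsElliptic] [W.IsGloballyMinimal] [NeZero (W.conductorNorm ℤ)] (hcm : ¬ W.HasCM) (hΔ : W.Δ < 0)
    (hT : Odd W.tamagawaProduct) (K : Type) [Field K] [NumberField K] (hIQ : IsImaginaryQuadratic K)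
    (hodd : Odd (NumberField.discr K)) (h3 : NumberField.discr K ≠ -3) (hHe : SatisfiesHeegnerHypothesis (W.conductorNorm ℤ) K)
    (hns : ¬ IsSquare ((NumberField.discr K : ℚ) * -|W.Δ|))
    (hρ : ∀ n : ℕ, 0 < n → W.HasSurjectiveModNGaloisRep ((2 : ℤ) ^ n))
    (Dt : ModularParametrizationData W (W.conductorNorm ℤ)) (β : ℤ) (ι : K →+* ℂ) (d₁ : KolyvaginHeegnerData Dt β ι 1)
    (hy : ¬ IsOfFinAddOrder d₁.derivedPoint) (M₀ : ℕ)
    (hM₀ : ∃ Q : (W.baseChange (ringClassField K ι 1)).toAffine.Point, ((2 ^ M₀ : ℕ) : ℤ) • Q = d₁.derivedPoint)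
    (hndiv : ¬ ∃ Q : (W.baseChange (ringClassField K ι 1)).toAffine.Point, ((2 ^ (M₀ + 1) : ℕ) : ℤ) • Q = d₁.derivedPoint)
    (Wd : WeierstrassCurve ℚ) [Wd.IsElliptic] (hTw : ∃ C : VariableChange ℚ, C • W.quadraticTwist (NumberField.discr K : ℚ) = Wd)
    {L k : ℕ} (hL : 2 * M₀ + 12 ≤ L) (hk : 1 ≤ k)
    (hNPh : ∀ z : galH1Torsion (W.baseChange K) ((2 ^ (L + k) : ℕ) : ℤ),
      (∀ ρ ∈ torsionFixing (W.baseChange K) ((2 ^ (L + k) : ℕ) : ℤ),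
        h1Eval (W.baseChange K) ((2 ^ (L + k) : ℕ) : ℤ) z ρ = 0) →
      (∀ w : HeightOneSpectrum (𝓞 K), ((2 * W.conductorNorm ℤ : ℕ) : 𝓞 K) ∈ w.asIdeal →
        z ∈ selmerLocalKer (W.baseChange K) (w.adicCompletion K) ((2 ^ (L + k) : ℕ) : ℤ)) → z = 0)
    {n₀ : ℕ} (hn₀ : Squarefree n₀)
    (hn₀K : ∀ q ∈ n₀.primeFactors, Zhang2014.IsKolyvaginPrime (W.conductorNorm ℤ) W K 2 q ∧ 2 ≤ Zhang2014.kolyvaginIndex W 2 q ∧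
      FrobEqFrobInfty W K (2 ^ 2) q)
    (e₀ : KolyvaginHeegnerData Dt β ι n₀) (he₀ : addOrderOf (e₀.kolyvaginClass Nat.prime_two 2) = 2 ^ 2) :
    ∃ (T : ℕ) (M : ℕ → ℕ), (∀ j, M (j + 1) ≤ M j) ∧ M 0 = M₀ ∧ M (2 * T) = 0 ∧
      (∀ m < T, ∃ x : Fin (2 * m + 2) → W.galH1, (∀ i, resBaseChange W K (x i) ∈ (W.baseChange K).sha) ∧
        (∀ i, addOrderOf (x i) = 2 ^ (M (2 * m) - M (2 * m + 1))) ∧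
        ∀ c : Fin (2 * m + 2) → ℤ, ∑ i, c i • x i = 0 → ∀ i, ((2 ^ (M (2 * m) - M (2 * m + 1)) : ℕ) : ℤ) ∣ c i) ∧
      (∀ m < T, ∃ x : Fin (2 * m + 2) → Wd.galH1, (∀ i, resBaseChange Wd K (x i) ∈ (Wd.baseChange K).sha) ∧
        (∀ i, addOrderOf (x i) = 2 ^ (M (2 * m + 1) - M (2 * m + 2))) ∧
        ∀ c : Fin (2 * m + 2) → ℤ, ∑ i, c i • x i = 0 → ∀ i, ((2 ^ (M (2 * m + 1) - M (2 * m + 2)) : ℕ) : ℤ) ∣ c i) := by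
  haveI : ∀ j : ℕ, NumberField (ringClassField K ι j) := JET.numberField_ringClassField K hIQ ι
  have hρ' := MinimalTwinBSDTwo.forall_hasSurjectiveModNGaloisRep_two_pow_of_pos W hρ
  exact twinShaLadders_of_deepSwap hP hQ2 W hcm hΔ hT K hIQ hodd h3 hHe hns hρ Dt β ι d₁ hy M₀ hM₀ hndiv Wd hTw (L := L)
    (by omega) k (fun z hz hzS ↦ hNPh z hz fun w _ ↦ hzS w)
    (fun q ↦ L + k ≤ Zhang2014.kolyvaginIndex W 2 q ∧ FrobEqFrobInfty W K (2 ^ (L + k)) q) (fun q _ hidx hF ↦ ⟨hidx, hF⟩)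
    (TransverseValue.hbot_socket_margin_of_three_le W hQ2 hcm hΔ hT hρ' hIQ hodd h3 hHe hns Dt β ι (L := L) (by omega) k
      (by omega) hNPh _ (fun q _ hidx hF ↦ ⟨hidx, hF⟩) hn₀ hn₀K e₀ he₀)
    (fun τ hτ ↦ deepSwap_socket W hcm hΔ hT hρ' hIQ hodd h3 hns hHe τ hτ Dt β ι hQ2 hL hk hNPh)
    (fun τ hτ r ℓ hℓ C hC ↦ hK_socket_margin W hΔ hIQ hτ (L := L) (by omega) r k ℓ hℓ C hC)

/-- **Stub L's conclusion ON THE CUT HABITAT, modulo Q2, `PubInputsAtTwo` and a level-`2` Gross witness only** (as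
`kolyvaginSuppliesAtTwo_of_grossWitness_onHabitat`: (NPh) discharged at the multiplicative place, witness `P(n₀) ∉ 2E(K[n₀])`).
[cite: McCallumLMS1991, §5 Prop. 5.2, Thm. 5.4] [cite: GrossLMS1991, Thm. 1.3, §3 (3.3)] [cite: LawsonWuthrich2016, §7.1] -/
theorem twinShaLadders_of_grossWitness_onHabitat (hP : PubInputsAtTwo) (hQ2 : KolyvaginRelationAtTwo)
    (W : WeierstrassCurve ℚ) [W.IsElliptic] [W.IsGloballyMinimal] [NeZero (W.conductorNorm ℤ)] (hcm : ¬ W.HasCM) (hΔ : W.Δ < 0)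
    (hT : Odd W.tamagawaProduct) (K : Type) [Field K] [NumberField K] (hIQ : IsImaginaryQuadratic K)
    (hodd : Odd (NumberField.discr K)) (h3 : NumberField.discr K ≠ -3) (hHe : SatisfiesHeegnerHypothesis (W.conductorNorm ℤ) K)
    (hns : ¬ IsSquare ((NumberField.discr K : ℚ) * -|W.Δ|))
    (hns₂ : ¬ IsSquare ((NumberField.discr K : ℚ) * (-(2 * |W.Δ|))))
    (hρ : ∀ n : ℕ, 0 < n → W.HasSurjectiveModNGaloisRep ((2 : ℤ) ^ n))
    {v : HeightOneSpectrum (𝓞 ℚ)} (h2v : ((2 : ℕ) : 𝓞 ℚ) ∉ v.asIdeal) (hNv : ((W.conductorNorm ℤ : ℕ) : 𝓞 ℚ) ∈ v.asIdeal)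
    (hmult : W.HasMultiplicativeReductionAt v)
    (Dt : ModularParametrizationData W (W.conductorNorm ℤ)) (β : ℤ) (ι : K →+* ℂ) (d₁ : KolyvaginHeegnerData Dt β ι 1)
    (hy : ¬ IsOfFinAddOrder d₁.derivedPoint) (M₀ : ℕ)
    (hM₀ : ∃ Q : (W.baseChange (ringClassField K ι 1)).toAffine.Point, ((2 ^ M₀ : ℕ) : ℤ) • Q = d₁.derivedPoint)
    (hndiv : ¬ ∃ Q : (W.baseChange (ringClassField K ι 1)).toAffine.Point, ((2 ^ (M₀ + 1) : ℕ) : ℤ) • Q = d₁.derivedPoint)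
    (Wd : WeierstrassCurve ℚ) [Wd.IsElliptic] (hTw : ∃ C : VariableChange ℚ, C • W.quadraticTwist (NumberField.discr K : ℚ) = Wd)
    {L k : ℕ} (hL : 2 * M₀ + 12 ≤ L) (hk : 1 ≤ k)
    {n₀ : ℕ} (hn₀ : Squarefree n₀)
    (hn₀K : ∀ q ∈ n₀.primeFactors, Zhang2014.IsKolyvaginPrime (W.conductorNorm ℤ) W K 2 q ∧ 2 ≤ Zhang2014.kolyvaginIndex W 2 q ∧
      FrobEqFrobInfty W K 2 q)
    (e₀ : KolyvaginHeegnerData Dt β ι n₀)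
    (he₀ : ¬ ∃ Q : (W.baseChange (ringClassField K ι n₀)).toAffine.Point, (2 : ℤ) • Q = e₀.derivedPoint) :
    ∃ (T : ℕ) (M : ℕ → ℕ), (∀ j, M (j + 1) ≤ M j) ∧ M 0 = M₀ ∧ M (2 * T) = 0 ∧
      (∀ m < T, ∃ x : Fin (2 * m + 2) → W.galH1, (∀ i, resBaseChange W K (x i) ∈ (W.baseChange K).sha) ∧
        (∀ i, addOrderOf (x i) = 2 ^ (M (2 * m) - M (2 * m + 1))) ∧
        ∀ c : Fin (2 * m + 2) → ℤ, ∑ i, c i • x i = 0 → ∀ i, ((2 ^ (M (2 * m) - M (2 * m + 1)) : ℕ) : ℤ) ∣ c i) ∧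
      (∀ m < T, ∃ x : Fin (2 * m + 2) → Wd.galH1, (∀ i, resBaseChange Wd K (x i) ∈ (Wd.baseChange K).sha) ∧
        (∀ i, addOrderOf (x i) = 2 ^ (M (2 * m + 1) - M (2 * m + 2))) ∧
        ∀ c : Fin (2 * m + 2) → ℤ, ∑ i, c i • x i = 0 → ∀ i, ((2 ^ (M (2 * m + 1) - M (2 * m + 2)) : ℕ) : ℤ) ∣ c i) := by
  haveI : ∀ j : ℕ, NumberField (ringClassField K ι j) := JET.numberField_ringClassField K hIQ ι
  have hρ' := MinimalTwinBSDTwo.forall_hasSurjectiveModNGaloisRep_two_pow_of_pos W hρ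
  have hNPh := NonPhantomPow.nonPhantomAtTwo_of_hasMultiplicativeReductionAt W hT hρ hIQ hodd hns hns₂
    (NeZero.ne (W.conductorNorm ℤ)) hHe h2v hNv hmult (L + k) (by omega)
  exact twinShaLadders_of_deepSwap hP hQ2 W hcm hΔ hT K hIQ hodd h3 hHe hns hρ Dt β ι d₁ hy M₀ hM₀ hndiv Wd hTw (L := L)
    (by omega) k (fun z hz hzS ↦ hNPh z hz fun w _ ↦ hzS w)
    (fun q ↦ L + k ≤ Zhang2014.kolyvaginIndex W 2 q ∧ FrobEqFrobInfty W K (2 ^ (L + k)) q) (fun q _ hidx hF ↦ ⟨hidx, hF⟩)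
    (TransverseValue.hbot_socket_margin_onHabitat_of_three_le W hQ2 hcm hΔ hT hρ' hIQ hodd h3 hHe hns hns₂ h2v hNv hmult Dt β ι
      (L := L) (by omega) k (by omega) _ (fun q _ hidx hF ↦ ⟨hidx, hF⟩) hn₀ hn₀K e₀ he₀)
    (fun τ hτ ↦ deepSwap_socket W hcm hΔ hT hρ' hIQ hodd h3 hns hHe τ hτ Dt β ι hQ2 hL hk hNPh)
    (fun τ hτ r ℓ hℓ C hC ↦ hK_socket_margin W hΔ hIQ hτ (L := L) (by omega) r k ℓ hℓ C hC)

end Summit.BirchSwinnertonDyer.BirchSwinnertonDyer.Theorems.GenusExact.PlusDescent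

end
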